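import Summits.Ventures.LatticeQCDFlow.Exactness.Phi4FlowSquareIntegrableCeiling
import Summits.Ventures.LatticeQCDFlow.Exactness.FlowSamplerMixtureHarmonicMean
import HarnessLib

/-!
# The DEFENSIVE MIXTURE makes every flow safe for both estimators: mixing any flow with the explicit
# Gaussian (weight `1 − α`) bounds the importance weights by `e^{K} Z_p/(1 − α)`, so the exact chain is
# uniformly ergodic and every square-integrable observable has finite reweighting variance

HONEST FRAMING: exact (Metropolis-corrected) sampling algorithms for lattice gauge theory;
figures of merit are autocorrelation/cost numbers at stated couplings and volumes; no
continuum-physics claim.  (SCALAR calibration rung S0-A: not a gauge result.)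

Venture `LatticeQCDFlow` (cell pub-lqcd), topic `Exactness`; FANOUT row 2 (`s0-phi4`, FLOW arm).
NEW WORK of the cell assembled from tree theorems (nothing is cited as a fact; no definition —
the Gaussian component is the tree's `momentumWeight/momentumZ`, the law `N(0,1)^Λ`).  Printed
counterpart NAMED ONLY: T. Hesterberg, *Weighted average importance sampling and defensive mixture
distributions*, Technometrics 37 (1995); A. Owen, Y. Zhou, *Safe and effective importance sampling*,
JASA 95 (2000) — replacing a proposal `q̃` by `α q̃ + (1 − α) g` with a heavy explicit `g` bounds the
importance weights.  Row 2's `Phi4FlowSamplerGaussianMinorant` proved: a Gaussian minorant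
`q̃ ≥ c e^{−κΣφ²}` makes the φ⁴ flow sampler uniformly ergodic with an explicit constant (the quartic
action beats every Gaussian, `latticePhi4Action_coercive_kappa`).  A trained flow need not have
such a minorant (light tails in some direction ⇒ `sup e^{−S}/q̃ = ∞`); but the defensive mixture

  `q̄ = α q̃ + (1 − α) e^{−Σφ²/2}/Z_p`   (`Z_p = momentumZ = (2π)^{(n+1)/2}`, `0 ≤ α < 1`)

ALWAYS has one (`c = (1 − α)/Z_p`, `κ = ½`), for EVERY positive normalised flow `q̃`.  Hence, with
`K = (n+1)(M_J + ½)²/(4λ)`, `M_J = Σ|J_yz|`: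

* the exact flow sampler driven by `q̄` is exact and UNIFORMLY ERGODIC,
  `|μK̄ᵗ(A) − π(A)| ≤ (1 − (1−α) Z e^{−K}/Z_p)ᵗ` from every start;
* every `f ∈ PolyObs` has a summable series along it and `τ_int(f) ≤ e^{K}Z_p/((1−α)Z) − ½`
  (`phi4Flow_defensive_tauInt_le_poly`, via the tree's weight-bound ceiling);
* the importance weight is BOUNDED, `e^{−S}/q̄ ≤ e^{K} Z_p/(1 − α)`, so `W₂(q̄) ≤ e^{K} Z_p Z/(1−α)`
  (Kish fraction `κ(q̄) ≥ (1−α) Z e^{−K}/Z_p > 0`) and, for EVERY `g` with `g² e^{−S} ∈ L¹`,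
  `∫ g² (e^{−S}/q̄) e^{−S} ≤ (e^{K} Z_p/(1−α)) ∫ g² e^{−S}` — finite reweighting variance
  (GEN-24 #5: equivalently a summable series along the exact chain) for the whole of `L²(π)`.

* and the PRICE on the chain side is at most the factor `1/α` on `τ_int + ½`, observable by
  observable (`phi4Flow_defensive_tauInt_le_bare`, GEN-23's `finMixture_tauInt_le_single`).

Reading for S0-A (no numerics implied): a `1 − α` admixture of the free Gaussian proposal is a
certified insurance for any trained flow, for the accept/reject chain and for reweighting alike, at a
certified price of at most `1/α` on `τ_int + ½` (the reweighting-side price — diluted weights where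
the flow was good — is the convexity of GEN-24 #7, not restated).
NOT CLAIMED: the size of `K` (astronomically pessimistic: a worst-case constant), any statement that
the mixture IMPROVES a given flow, values for any network or run; HMC / local arms.
-/

namespace Summit.Ventures.LatticeQCDFlow.Exactness

open Real MeasureTheory ProbabilityTheory Filter Finset Set
open Summit.Ventures.LatticeQCDFlow.Scoring

variable {n : ℕ}

/-! ## §1 The defensive mixture is a positive normalised density with a Gaussian minorant -/

/-- The mixture is positive (`q̃ > 0`, `0 ≤ α < 1`). -/
theorem defensiveMixture_pos {q : (Fin (n + 1) → ℝ) → ℝ} (hq0 : ∀ φ, 0 < q φ) {α : ℝ}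
    (hα0 : 0 ≤ α) (hα1 : α < 1) (φ : Fin (n + 1) → ℝ) :
    0 < α * q φ + (1 - α) * (momentumWeight φ / momentumZ n) :=
  add_pos_of_nonneg_of_pos (mul_nonneg hα0 (hq0 φ).le)
    (mul_pos (by linarith) (div_pos (momentumWeight_pos φ) (momentumZ_pos n)))

/-- The mixture is measurable. -/
theorem defensiveMixture_measurable {q : (Fin (n + 1) → ℝ) → ℝ} (hqm : Measurable q) (α : ℝ) :
    Measurable fun φ : Fin (n + 1) → ℝ => α * q φ + (1 - α) * (momentumWeight φ / momentumZ n) :=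
  (hqm.const_mul α).add ((measurable_momentumWeight.div_const _).const_mul _)

/-- The mixture is integrable. -/
theorem defensiveMixture_integrable {q : (Fin (n + 1) → ℝ) → ℝ} (hqi : Integrable q) (α : ℝ) :
    Integrable fun φ : Fin (n + 1) → ℝ => α * q φ + (1 - α) * (momentumWeight φ / momentumZ n) :=
  (hqi.const_mul α).add ((integrable_momentumWeight.div_const _).const_mul _)

/-- The mixture has total mass one. -/
theorem defensiveMixture_integral {q : (Fin (n + 1) → ℝ) → ℝ} (hqi : Integrable q)
    (hq1 : ∫ φ, q φ = 1) (α : ℝ) :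
    ∫ φ : Fin (n + 1) → ℝ, (α * q φ + (1 - α) * (momentumWeight φ / momentumZ n)) = 1 := by
  rw [integral_add (hqi.const_mul α) ((integrable_momentumWeight.div_const _).const_mul _),
    integral_const_mul, integral_const_mul, integral_div, hq1]
  have hZ := (momentumZ_pos n).ne'
  rw [show (∫ φ : Fin (n + 1) → ℝ, momentumWeight φ) = momentumZ n from rfl, div_self hZ]
  ring

/-- **The Gaussian minorant of the mixture**: `((1 − α)/Z_p) · e^{−(½)Σφ²} ≤ q̄(φ)` for every `φ`
(`q̃ ≥ 0`, `α ≥ 0`). -/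
theorem defensiveMixture_gaussian_minorant {q : (Fin (n + 1) → ℝ) → ℝ} (hq0 : ∀ φ, 0 < q φ)
    {α : ℝ} (hα0 : 0 ≤ α) (φ : Fin (n + 1) → ℝ) :
    (1 - α) / momentumZ n * Real.exp (-((1 / 2) * ∑ w, φ w ^ 2))
      ≤ α * q φ + (1 - α) * (momentumWeight φ / momentumZ n) := by
  have e : Real.exp (-((1 / 2) * ∑ w, φ w ^ 2)) = momentumWeight φ := by
    unfold momentumWeight
    congr 1
    ring
  rw [e]
  have h0 : 0 ≤ α * q φ := mul_nonneg hα0 (hq0 φ).le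
  have e2 : (1 - α) / momentumZ n * momentumWeight φ = (1 - α) * (momentumWeight φ / momentumZ n) := by
    ring
  linarith [e2]

/-! ## §2 The chain side: exact and uniformly ergodic, for EVERY flow -/

/-- **THE DEFENSIVE FLOW SAMPLER IS UNIFORMLY ERGODIC FOR EVERY FLOW** (`λ > 0`, real `J`, any
positive measurable `q̃` with `∫ q̃ = 1`, `0 ≤ α < 1`): the exact flow sampler driven by
`q̄ = αq̃ + (1−α)e^{−Σφ²/2}/Z_p` leaves `phi4GibbsMeasure J λ` invariant and
`|μK̄ᵗ(A) − π(A)| ≤ (1 − ((1−α)/Z_p) Z e^{−K})ᵗ`, `K = (n+1)(M_J + ½)²/(4λ)`, for every initial law,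
every `t`, every measurable set. -/
theorem phi4FlowSampler_defensive_uniformly_ergodic {lam : ℝ} (hlam : 0 < lam)
    (J : Fin (n + 1) → Fin (n + 1) → ℝ) {q : (Fin (n + 1) → ℝ) → ℝ} (hq0 : ∀ φ, 0 < q φ)
    (hqm : Measurable q) (hqi : Integrable q) (hq1 : ∫ φ, q φ = 1) {α : ℝ} (hα0 : 0 ≤ α)
    (hα1 : α < 1) :
    haveI := isProbabilityMeasure_flowModel (defensiveMixture_pos hq0 hα0 hα1)
      (defensiveMixture_integrable hqi α) (defensiveMixture_integral hqi hq1 α)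
    Kernel.Invariant (phi4FlowKernel J lam
        (fun φ => α * q φ + (1 - α) * (momentumWeight φ / momentumZ n))) (phi4GibbsMeasure J lam) ∧
      ∀ (μ : Measure (Fin (n + 1) → ℝ)) [IsProbabilityMeasure μ] (t : ℕ)
        (A : Set (Fin (n + 1) → ℝ)),
        |((fun m : Measure (Fin (n + 1) → ℝ) => m.bind (phi4FlowKernel J lam
            (fun φ => α * q φ + (1 - α) * (momentumWeight φ / momentumZ n))))^[t] μ).real A
            - (phi4GibbsMeasure J lam).real A|
          ≤ (1 - (1 - α) / momentumZ n * gibbsZ J lam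
              * Real.exp (-((n + 1) * (((∑ y, ∑ z, |J y z|) + 1 / 2) ^ 2 / (4 * lam))))) ^ t :=
  phi4FlowSampler_uniformly_ergodic_of_gaussian_minorant hlam J (defensiveMixture_pos hq0 hα0 hα1)
    (defensiveMixture_measurable hqm α) (defensiveMixture_integrable hqi α)
    (defensiveMixture_integral hqi hq1 α) (div_pos (by linarith) (momentumZ_pos n))
    (defensiveMixture_gaussian_minorant hq0 hα0)

/-- **The defensive sampler accepts from EVERY configuration with probability at least
`((1−α)/Z_p) Z e^{−K}`** (a Doeblin constant uniform in the flow). -/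
theorem phi4FlowSampler_defensive_acceptMass_ge {lam : ℝ} (hlam : 0 < lam)
    (J : Fin (n + 1) → Fin (n + 1) → ℝ) {q : (Fin (n + 1) → ℝ) → ℝ} (hq0 : ∀ φ, 0 < q φ)
    (hqm : Measurable q) {α : ℝ} (hα0 : 0 ≤ α) (hα1 : α < 1) (φ : Fin (n + 1) → ℝ) :
    ENNReal.ofReal ((1 - α) / momentumZ n * gibbsZ J lam
        * Real.exp (-((n + 1) * (((∑ y, ∑ z, |J y z|) + 1 / 2) ^ 2 / (4 * lam)))))
      ≤ imhAcceptMass (flowModel fun φ => α * q φ + (1 - α) * (momentumWeight φ / momentumZ n))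
          (fun φ => gibbsWeight J lam φ / (α * q φ + (1 - α) * (momentumWeight φ / momentumZ n))) φ :=
  phi4FlowSampler_acceptMass_ge hlam J (defensiveMixture_pos hq0 hα0 hα1)
    (defensiveMixture_measurable hqm α) (div_pos (by linarith) (momentumZ_pos n))
    (defensiveMixture_gaussian_minorant hq0 hα0) φ

/-! ## §3 The reweighting side: bounded weights, finite variance for every `L²` observable -/

/-- **THE DEFENSIVE WEIGHT IS BOUNDED**: `e^{−S(φ)}/q̄(φ) ≤ e^{K} Z_p/(1 − α)` for every `φ`. -/
theorem phi4Flow_defensive_weight_le {lam : ℝ} (hlam : 0 < lam)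
    (J : Fin (n + 1) → Fin (n + 1) → ℝ) {q : (Fin (n + 1) → ℝ) → ℝ} (hq0 : ∀ φ, 0 < q φ)
    {α : ℝ} (hα0 : 0 ≤ α) (hα1 : α < 1) (φ : Fin (n + 1) → ℝ) :
    gibbsWeight J lam φ / (α * q φ + (1 - α) * (momentumWeight φ / momentumZ n))
      ≤ Real.exp ((n + 1) * (((∑ y, ∑ z, |J y z|) + 1 / 2) ^ 2 / (4 * lam)))
          * momentumZ n / (1 - α) := by
  have hqbar := defensiveMixture_pos hq0 hα0 hα1 φ
  have hc : 0 < (1 - α) / momentumZ n := div_pos (by linarith) (momentumZ_pos n)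
  have h := gibbsWeight_le_of_gaussian_minorant hlam J hc (defensiveMixture_gaussian_minorant hq0 hα0) φ
  rw [div_le_iff₀ hqbar]
  have e : Real.exp ((n + 1) * (((∑ y, ∑ z, |J y z|) + 1 / 2) ^ 2 / (4 * lam))) / ((1 - α) / momentumZ n)
      = Real.exp ((n + 1) * (((∑ y, ∑ z, |J y z|) + 1 / 2) ^ 2 / (4 * lam))) * momentumZ n / (1 - α) := by
    have h1 : (1 - α) ≠ 0 := by linarith
    have h2 := (momentumZ_pos n).ne'
    field_simp
  rw [← e]
  exact h

/-- **FINITE SECOND WEIGHT MOMENT FOR EVERY FLOW**: `W₂(q̄) = ∫ (e^{−S}/q̄) e^{−S} ≤ (e^{K} Z_p/(1−α))·Z`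
— the Kish fraction of the defensive mixture is at least `(1−α) Z e^{−K}/Z_p`, whatever the flow. -/
theorem phi4Flow_defensive_weightMoment_le {lam : ℝ} (hlam : 0 < lam)
    (J : Fin (n + 1) → Fin (n + 1) → ℝ) {q : (Fin (n + 1) → ℝ) → ℝ} (hq0 : ∀ φ, 0 < q φ)
    (hqm : Measurable q) {α : ℝ} (hα0 : 0 ≤ α) (hα1 : α < 1) :
    Integrable (fun φ => gibbsWeight J lam φ / (α * q φ + (1 - α) * (momentumWeight φ / momentumZ n))
      * gibbsWeight J lam φ) ∧
    ∫ φ, gibbsWeight J lam φ / (α * q φ + (1 - α) * (momentumWeight φ / momentumZ n))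
        * gibbsWeight J lam φ
      ≤ Real.exp ((n + 1) * (((∑ y, ∑ z, |J y z|) + 1 / 2) ^ 2 / (4 * lam)))
          * momentumZ n / (1 - α) * gibbsZ J lam := by
  set C := Real.exp ((n + 1) * (((∑ y, ∑ z, |J y z|) + 1 / 2) ^ 2 / (4 * lam)))
      * momentumZ n / (1 - α) with hC
  have hw := integrable_gibbsWeight hlam J
  have hb := phi4Flow_defensive_weight_le hlam J hq0 hα0 hα1
  have hqbar := defensiveMixture_pos hq0 hα0 hα1
  have hm : Measurable fun φ => gibbsWeight J lam φ
      / (α * q φ + (1 - α) * (momentumWeight φ / momentumZ n)) * gibbsWeight J lam φ :=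
    ((continuous_gibbsWeight J lam).measurable.div (defensiveMixture_measurable hqm α)).mul
      (continuous_gibbsWeight J lam).measurable
  have h0 : ∀ φ, 0 ≤ gibbsWeight J lam φ
      / (α * q φ + (1 - α) * (momentumWeight φ / momentumZ n)) * gibbsWeight J lam φ := fun φ =>
    mul_nonneg (div_pos (gibbsWeight_pos J lam φ) (hqbar φ)).le (gibbsWeight_pos J lam φ).le
  have hpt : ∀ φ, gibbsWeight J lam φ
      / (α * q φ + (1 - α) * (momentumWeight φ / momentumZ n)) * gibbsWeight J lam φ
        ≤ C * gibbsWeight J lam φ := fun φ =>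
    mul_le_mul_of_nonneg_right (hb φ) (gibbsWeight_pos J lam φ).le
  have hint : Integrable (fun φ => gibbsWeight J lam φ
      / (α * q φ + (1 - α) * (momentumWeight φ / momentumZ n)) * gibbsWeight J lam φ) :=
    (hw.const_mul C).mono' hm.aestronglyMeasurable (Eventually.of_forall fun φ => by
      rw [Real.norm_eq_abs, abs_of_nonneg (h0 φ)]; exact hpt φ)
  refine ⟨hint, ?_⟩
  calc ∫ φ, gibbsWeight J lam φ / (α * q φ + (1 - α) * (momentumWeight φ / momentumZ n))
          * gibbsWeight J lam φ
      ≤ ∫ φ, C * gibbsWeight J lam φ := integral_mono hint (hw.const_mul C) hpt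
    _ = C * gibbsZ J lam := by rw [integral_const_mul]; rfl

/-- **FINITE REWEIGHTING VARIANCE FOR EVERY SQUARE-INTEGRABLE OBSERVABLE, FOR EVERY FLOW**: for every
measurable `g` with `g² e^{−S} ∈ L¹`, the defensive reweighting moment satisfies
`∫ g² (e^{−S}/q̄) e^{−S} ≤ (e^{K} Z_p/(1−α)) · ∫ g² e^{−S}` (so `σ²_RW(g; q̄) ≤ (e^{K} Z_p/((1−α)Z))·E_π[g²]`). -/
theorem phi4Flow_defensive_reweightMoment_le {lam : ℝ} (hlam : 0 < lam)
    (J : Fin (n + 1) → Fin (n + 1) → ℝ) {q : (Fin (n + 1) → ℝ) → ℝ} (hq0 : ∀ φ, 0 < q φ)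
    (hqm : Measurable q) {α : ℝ} (hα0 : 0 ≤ α) (hα1 : α < 1)
    {g : (Fin (n + 1) → ℝ) → ℝ} (hgm : Measurable g)
    (hg2 : Integrable (fun φ => g φ ^ 2 * gibbsWeight J lam φ)) :
    Integrable (fun φ => g φ ^ 2 * (gibbsWeight J lam φ
      / (α * q φ + (1 - α) * (momentumWeight φ / momentumZ n)) * gibbsWeight J lam φ)) ∧
    ∫ φ, g φ ^ 2 * (gibbsWeight J lam φ
        / (α * q φ + (1 - α) * (momentumWeight φ / momentumZ n)) * gibbsWeight J lam φ)
      ≤ Real.exp ((n + 1) * (((∑ y, ∑ z, |J y z|) + 1 / 2) ^ 2 / (4 * lam)))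
          * momentumZ n / (1 - α) * ∫ φ, g φ ^ 2 * gibbsWeight J lam φ := by
  set C := Real.exp ((n + 1) * (((∑ y, ∑ z, |J y z|) + 1 / 2) ^ 2 / (4 * lam)))
      * momentumZ n / (1 - α) with hC
  have hb := phi4Flow_defensive_weight_le hlam J hq0 hα0 hα1
  have hqbar := defensiveMixture_pos hq0 hα0 hα1
  have hwm := (continuous_gibbsWeight J lam).measurable
  have hm : Measurable fun φ => g φ ^ 2 * (gibbsWeight J lam φ
      / (α * q φ + (1 - α) * (momentumWeight φ / momentumZ n)) * gibbsWeight J lam φ) :=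
    (hgm.pow_const 2).mul ((hwm.div (defensiveMixture_measurable hqm α)).mul hwm)
  have h0 : ∀ φ, 0 ≤ g φ ^ 2 * (gibbsWeight J lam φ
      / (α * q φ + (1 - α) * (momentumWeight φ / momentumZ n)) * gibbsWeight J lam φ) := fun φ =>
    mul_nonneg (sq_nonneg _) (mul_nonneg (div_pos (gibbsWeight_pos J lam φ) (hqbar φ)).le
      (gibbsWeight_pos J lam φ).le)
  have hpt : ∀ φ, g φ ^ 2 * (gibbsWeight J lam φ
      / (α * q φ + (1 - α) * (momentumWeight φ / momentumZ n)) * gibbsWeight J lam φ)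
        ≤ C * (g φ ^ 2 * gibbsWeight J lam φ) := fun φ => by
    have h := mul_le_mul_of_nonneg_left
      (mul_le_mul_of_nonneg_right (hb φ) (gibbsWeight_pos J lam φ).le) (sq_nonneg (g φ))
    linarith [h]
  have hint : Integrable (fun φ => g φ ^ 2 * (gibbsWeight J lam φ
      / (α * q φ + (1 - α) * (momentumWeight φ / momentumZ n)) * gibbsWeight J lam φ)) :=
    (hg2.const_mul C).mono' hm.aestronglyMeasurable (Eventually.of_forall fun φ => by
      rw [Real.norm_eq_abs, abs_of_nonneg (h0 φ)]; exact hpt φ)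
  refine ⟨hint, ?_⟩
  calc ∫ φ, g φ ^ 2 * (gibbsWeight J lam φ
          / (α * q φ + (1 - α) * (momentumWeight φ / momentumZ n)) * gibbsWeight J lam φ)
      ≤ ∫ φ, C * (g φ ^ 2 * gibbsWeight J lam φ) := integral_mono hint (hg2.const_mul C) hpt
    _ = C * ∫ φ, g φ ^ 2 * gibbsWeight J lam φ := integral_const_mul _ _

/-! ## §4 Every polynomial observable: summable series and an explicit `τ_int` ceiling -/

/-- **FOR EVERY FLOW, EVERY `f ∈ PolyObs` DECORRELATES ALONG THE DEFENSIVE SAMPLER WITH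
`τ_int(f) ≤ e^{K} Z_p/((1−α) Z) − ½`** (`Var f > 0`): the weight bound feeds the tree's
`phi4Flow_tauInt_le_weightBound_poly` (summability included). -/
theorem phi4Flow_defensive_tauInt_le_poly {lam : ℝ} (hlam : 0 < lam)
    (J : Fin (n + 1) → Fin (n + 1) → ℝ) {q : (Fin (n + 1) → ℝ) → ℝ} (hq0 : ∀ φ, 0 < q φ)
    (hqm : Measurable q) (hqi : Integrable q) (hq1 : ∫ φ, q φ = 1) {α : ℝ} (hα0 : 0 ≤ α)
    (hα1 : α < 1) {f : (Fin (n + 1) → ℝ) → ℝ} (hf : PolyObs f)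
    (hP : 0 < ∫ φ, (f φ - gibbsExpect J lam f) ^ 2 * gibbsWeight J lam φ) :
    (Summable fun k => (∫ φ, (f φ - gibbsExpect J lam f)
        * ((imhOpPhi4 J lam (fun φ => α * q φ + (1 - α) * (momentumWeight φ / momentumZ n)))^[k + 1]
            (fun ψ => f ψ - gibbsExpect J lam f)) φ * gibbsWeight J lam φ)
        / ∫ φ, (f φ - gibbsExpect J lam f) ^ 2 * gibbsWeight J lam φ) ∧
    tauInt (fun k => (∫ φ, (f φ - gibbsExpect J lam f)
        * ((imhOpPhi4 J lam (fun φ => α * q φ + (1 - α) * (momentumWeight φ / momentumZ n)))^[k]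
            (fun ψ => f ψ - gibbsExpect J lam f)) φ * gibbsWeight J lam φ)
        / ∫ φ, (f φ - gibbsExpect J lam f) ^ 2 * gibbsWeight J lam φ)
      ≤ Real.exp ((n + 1) * (((∑ y, ∑ z, |J y z|) + 1 / 2) ^ 2 / (4 * lam)))
          * momentumZ n / (1 - α) / gibbsZ J lam - 1 / 2 := by
  have hqbar := defensiveMixture_pos hq0 hα0 hα1
  have hC : ∀ φ, gibbsWeight J lam φ
      ≤ Real.exp ((n + 1) * (((∑ y, ∑ z, |J y z|) + 1 / 2) ^ 2 / (4 * lam)))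
          * momentumZ n / (1 - α) * (α * q φ + (1 - α) * (momentumWeight φ / momentumZ n)) :=
    fun φ => (div_le_iff₀ (hqbar φ)).1 (phi4Flow_defensive_weight_le hlam J hq0 hα0 hα1 φ)
  exact phi4Flow_tauInt_le_weightBound_poly hlam J hqbar (defensiveMixture_measurable hqm α)
    (defensiveMixture_integrable hqi α) (defensiveMixture_integral hqi hq1 α) hC hf hP

/-! ## §5 The price on the chain side: at most the factor `1/α` on `τ_int + ½`, observable by observable -/

/-- **DEFENSIVE MIXING COSTS AT MOST THE FACTOR `1/α` ON `τ_int + ½`** (`0 < α < 1`, `f ∈ PolyObs`,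
`Var f > 0`, a summable series along the BARE flow sampler): the series along the defensive sampler is
summable too and `τ_int^{q̄}(f) + ½ ≤ (τ_int^{q̃}(f) + ½)/α` — GEN-23's one-component mixture law
`finMixture_tauInt_le_single` with the two components `q̃` and `N(0,1)^Λ`. -/
theorem phi4Flow_defensive_tauInt_le_bare {lam : ℝ} (hlam : 0 < lam)
    (J : Fin (n + 1) → Fin (n + 1) → ℝ) {q : (Fin (n + 1) → ℝ) → ℝ} (hq0 : ∀ φ, 0 < q φ)
    (hqm : Measurable q) (hqi : Integrable q) (hq1 : ∫ φ, q φ = 1) {α : ℝ} (hα0 : 0 < α)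
    (hα1 : α < 1) {f : (Fin (n + 1) → ℝ) → ℝ} (hf : PolyObs f)
    (hP : 0 < ∫ φ, (f φ - gibbsExpect J lam f) ^ 2 * gibbsWeight J lam φ)
    (hs : Summable fun k => (∫ φ, (f φ - gibbsExpect J lam f)
        * ((imhOpPhi4 J lam q)^[k + 1] (fun ψ => f ψ - gibbsExpect J lam f)) φ * gibbsWeight J lam φ)
        / ∫ φ, (f φ - gibbsExpect J lam f) ^ 2 * gibbsWeight J lam φ) :
    (Summable fun k => (∫ φ, (f φ - gibbsExpect J lam f)
        * ((imhOpPhi4 J lam (fun φ => α * q φ + (1 - α) * (momentumWeight φ / momentumZ n)))^[k + 1]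
            (fun ψ => f ψ - gibbsExpect J lam f)) φ * gibbsWeight J lam φ)
        / ∫ φ, (f φ - gibbsExpect J lam f) ^ 2 * gibbsWeight J lam φ) ∧
    tauInt (fun k => (∫ φ, (f φ - gibbsExpect J lam f)
        * ((imhOpPhi4 J lam (fun φ => α * q φ + (1 - α) * (momentumWeight φ / momentumZ n)))^[k]
            (fun ψ => f ψ - gibbsExpect J lam f)) φ * gibbsWeight J lam φ)
        / ∫ φ, (f φ - gibbsExpect J lam f) ^ 2 * gibbsWeight J lam φ) + 1 / 2
      ≤ (tauInt (fun k => (∫ φ, (f φ - gibbsExpect J lam f)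
          * ((imhOpPhi4 J lam q)^[k] (fun ψ => f ψ - gibbsExpect J lam f)) φ * gibbsWeight J lam φ)
          / ∫ φ, (f φ - gibbsExpect J lam f) ^ 2 * gibbsWeight J lam φ) + 1 / 2) / α := by
  obtain ⟨hgm, hg2⟩ := polyObs_sq_integrable hlam J (polyObs_sub_const hf (gibbsExpect J lam f))
  -- the two-component family
  set αv : Fin 2 → ℝ := ![α, 1 - α] with hαv
  set qv : Fin 2 → (Fin (n + 1) → ℝ) → ℝ := ![q, fun φ => momentumWeight φ / momentumZ n] with hqv
  have hmix : (fun φ : Fin (n + 1) → ℝ => ∑ j, αv j * qv j φ)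
      = fun φ => α * q φ + (1 - α) * (momentumWeight φ / momentumZ n) := by
    funext φ
    simp [hαv, hqv, Fin.sum_univ_two]
  have hαpos : ∀ i, 0 < αv i := fun i => by
    fin_cases i
    · simpa [hαv] using hα0
    · simpa [hαv] using (by linarith : 0 < 1 - α)
  have hαsum : ∑ i, αv i = 1 := by simp [hαv, Fin.sum_univ_two]
  have hg0 : ∀ φ : Fin (n + 1) → ℝ, 0 < momentumWeight φ / momentumZ n := fun φ =>
    div_pos (momentumWeight_pos φ) (momentumZ_pos n)
  have hgi : Integrable (fun φ : Fin (n + 1) → ℝ => momentumWeight φ / momentumZ n) :=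
    integrable_momentumWeight.div_const _
  have hg1 : ∫ φ : Fin (n + 1) → ℝ, momentumWeight φ / momentumZ n = 1 := by
    rw [integral_div]; exact div_self (momentumZ_pos n).ne'
  have hq0v : ∀ i φ, 0 < qv i φ := fun i => by
    fin_cases i
    · simpa [hqv] using hq0
    · simpa [hqv] using hg0
  have hqmv : ∀ i, Measurable (qv i) := fun i => by
    fin_cases i
    · simpa [hqv] using hqm
    · simpa [hqv] using (measurable_momentumWeight.div_const (momentumZ n))
  have hqiv : ∀ i, Integrable (qv i) := fun i => by
    fin_cases i
    · simpa [hqv] using hqi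
    · simpa [hqv] using hgi
  have hq1v : ∀ i, ∫ φ, qv i φ = 1 := fun i => by
    fin_cases i
    · simpa [hqv] using hq1
    · simpa [hqv] using hg1
  rw [imhOpPhi4_eq_imhOp] at hs
  rw [imhOpPhi4_eq_imhOp, imhOpPhi4_eq_imhOp, ← hmix]
  have h := finMixture_tauInt_le_single (μ := volume) hαpos hαsum (fun φ => gibbsWeight_pos J lam φ)
    (continuous_gibbsWeight J lam).measurable (integrable_gibbsWeight hlam J) hq0v hqmv hqiv hq1v
    hgm hg2 hP (0 : Fin 2) (by simpa [hqv] using hs)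
  simpa [hqv, hαv] using h

end Summit.Ventures.LatticeQCDFlow.Exactness
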